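import Literature.AlgebraicGeometry.HodgeTheory.HomComplexSupertrace
import Literature.AlgebraicGeometry.HodgeTheory.HomComplexExact
import Literature.AlgebraicGeometry.HodgeTheory.ContractDinatural
import HarnessLib

/-!
# The supertrace `Tr• : 𝓗om•(E•, E• ⊗ G) ⟶ G[0]` is DINATURAL in the complex `E•`

PROMOTED LITERATURE COPY (librarian protocol (b); DEFREQ-CoherentISemiregular, cell pub-hsemireg) of the generic, conjecture-free
`Summits/Ventures/HSemireg/HomComplexSupertraceDinatural.lean` — namespace now `Literature.AlgebraicGeometry.HodgeTheory`, names kept; cell words (seats, ventures) = provenance.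

Cell `pub-hsemireg`, general-structure seat gs-g4; step (I4) of general-structure/SIGMA-INVARIANCE-PLAN-gs-g4.md (the
invariance of `σ_q^C` (`HomComplexSigma.lean`) along chain maps intertwining the classes — the model-independence a perfect-complex door
needs). Sequel to `HomComplexSupertrace.lean` (`supertrace`, natural in the coefficients `G`) and
`ContractDinatural.lean` (`contract_dinatural`, `tr(PQ) = tr(QP)` between different bundles), and
`HomComplexExact.lean` (`premap` = `𝓗om•(ψ, F•)`). HONEST FRAMING: infrastructure only — NOT a door, NOT a named fact,
NOT a statement about any variety, NOT a «K2 result»; nothing here says HC, HC_CM or HC_AV is proved.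

CONTENTS (all proved; Mathlib + tree only). For a chain map `f : E₁• ⟶ E₂•` between complexes with finite locally free
terms and a module `G`, on `𝓗om•(E₂•, E₁• ⊗ G)`:
* `strComp_dinatural`, `premap_str₀` — summandwise / degree-`0` forms (for an abstract `φ` equal to `f ⊗ 1_G` degreewise —
  see the KERNEL NOTE in the file);
* **`supertrace_dinatural`** (abstract `φ`), **`supertrace_dinatural_map`** (`φ = (twistFunctor X G).mapHomologicalComplex.map f`) —
  `𝓗om•(f, E₁• ⊗ G) ≫ Tr•_{E₁} = 𝓗om•(E₂•, f ⊗ 1_G) ≫ Tr•_{E₂} : 𝓗om•(E₂•, E₁• ⊗ G) ⟶ G[0]`, i.e.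
  `Tr_{E₁}(ψ ∘ f) = Tr_{E₂}((f ⊗ 1) ∘ ψ)` (supertrace cyclicity across two complexes).

## References
* R.-O. Buchweitz, H. Flenner, *A semiregularity map for modules and applications to deformations*, Compositio
  Math. 137 (2003), §4 (trace map for perfect complexes). [BuchweitzFlenner2003]
* L. Illusie, *Complexe cotangent et déformations I*, LNM 239 (1971), V.3 (trace). [Illusie1971]
-/

noncomputable section

open CategoryTheory CategoryTheory.Limits AlgebraicGeometry Opposite

namespace Literature.AlgebraicGeometry.HodgeTheory

open Literature.AlgebraicGeometry.Modules Literature.AlgebraicGeometry.Motives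
open Literature.AlgebraicGeometry.HodgeTheory

namespace HomComplex

section SupertraceDinatural

universe w

variable (X : Scheme.{w}) (G : X.Modules) {E₁ E₂ : CochainComplex X.Modules ℤ}
  (hE₁ : ∀ n, IsFiniteLocallyFree (E₁.X n)) (hE₂ : ∀ n, IsFiniteLocallyFree (E₂.X n)) (f : E₁ ⟶ E₂)
  (φ : twistG X G E₁ ⟶ twistG X G E₂)

/-! KERNEL NOTE (`HomComplexSigma.lean`): the chain map `f ⊗ 1_G` is taken as an ABSTRACT `φ : E₁• ⊗ G ⟶ E₂• ⊗ G`
with `φⁿ = fⁿ ⊗ 1` degreewise (hypothesis `hφ`), so that the two spellings `twistG X G E₂` / `((twistFunctor X G).mapHomologicalComplex _).obj E₂`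
of `E₂• ⊗ G` never meet under a projection `(𝓗om•(–, –)).X n` — when they do, the kernel exhausts memory. The functorial
instance is `supertrace_dinatural_map` below (named implicit arguments keep the spelling). -/

/-- On the summand `𝓗om(E₂^{-i}, E₁^{q} ⊗ G)` (`q + i = 0`): `(-1)^i str_{E₁^{-i}}(ψ ∘ f^{-i}) =
(-1)^i str_{E₂^{-i}}((f^{-i} ⊗ 1) ∘ ψ)` — `contract_dinatural` (`ContractDinatural.lean`). [cite: BuchweitzFlenner2003, §4 (trace map, before Def. 4.1)] -/
lemma strComp_dinatural (hφ : ∀ n, φ.f n = twistMap (f.f n) G) (q i : ℤ) (h : q + i = 0) :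
    sheafHomMapLeft (f.f (-i)) ((twistG X G E₁).X q) ≫ strComp X G E₁ hE₁ q i h =
      sheafHomMap (E₂.X (-i)) (φ.f q) ≫ strComp X G E₂ hE₂ q i h := by
  obtain rfl : q = -i := by omega
  rw [hφ]
  simp only [strComp, HomologicalComplex.XIsoOfEq_rfl, Iso.refl_hom, sheafHomMap_id, Category.id_comp]
  rw [Linear.comp_units_smul, Linear.comp_units_smul]
  congr 1
  exact contract_dinatural G (hE₁ (-i)) (hE₂ (-i)) (f.f (-i))

/-- In degree `0`: `𝓗om•(f, E₁• ⊗ G)^0 ≫ str₀^{E₁} = 𝓗om•(E₂•, f ⊗ 1)^0 ≫ str₀^{E₂}`. [cite: BuchweitzFlenner2003, §4 (trace map, before Def. 4.1)] -/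
lemma premap_str₀ (hφ : ∀ n, φ.f n = twistMap (f.f n) G) :
    (premap X f (twistG X G E₁)).f 0 ≫ str₀ X G E₁ hE₁ = (map X E₂ φ).f 0 ≫ str₀ X G E₂ hE₂ := by
  refine HomologicalComplex.mapBifunctor.hom_ext fun q i (h : q + i = 0) => ?_
  change ι X E₂ (twistG X G E₁) q i 0 h ≫ _ = ι X E₂ (twistG X G E₁) q i 0 h ≫ _
  rw [reassoc_of% (ι_premap X f (twistG X G E₁) q i 0 h), ι_str₀ X G E₁ hE₁ q i h,
    reassoc_of% (ι_map X E₂ φ q i 0 h), ι_str₀ X G E₂ hE₂ q i h]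
  exact strComp_dinatural X G hE₁ hE₂ f φ hφ q i h

/-- **The supertrace is dinatural in the complex** (`Tr_{E₁}(ψ ∘ f) = Tr_{E₂}((f ⊗ 1) ∘ ψ)`):
`𝓗om•(f, E₁• ⊗ G) ≫ Tr•_{E₁} = 𝓗om•(E₂•, f ⊗ 1_G) ≫ Tr•_{E₂}` as chain maps `𝓗om•(E₂•, E₁• ⊗ G) ⟶ G[0]`, for any chain map
`φ` that is `f ⊗ 1_G` degreewise. [cite: BuchweitzFlenner2003, §4 (trace map)] -/
theorem supertrace_dinatural (hφ : ∀ n, φ.f n = twistMap (f.f n) G) :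
    premap X f (twistG X G E₁) ≫ supertrace X G E₁ hE₁ = map X E₂ φ ≫ supertrace X G E₂ hE₂ :=
  HomologicalComplex.to_single_hom_ext (by
    simp only [supertrace, HomologicalComplex.comp_f, HomologicalComplex.mkHomToSingle_f]
    rw [← Category.assoc, premap_str₀ X G hE₁ hE₂ f φ hφ, Category.assoc])

omit φ in
/-- `supertrace_dinatural` for the functorial `f ⊗ 1_G = (twistFunctor X G).mapHomologicalComplex.map f` (the named implicit
arguments `F`, `F'` of `HomComplex.map` pin the spelling `twistG`, see the KERNEL NOTE). [cite: BuchweitzFlenner2003, §4 (trace map)] -/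
theorem supertrace_dinatural_map :
    premap X f (twistG X G E₁) ≫ supertrace X G E₁ hE₁ =
      map X E₂ (F := twistG X G E₁) (F' := twistG X G E₂)
          (((twistFunctor X G).mapHomologicalComplex (ComplexShape.up ℤ)).map f) ≫ supertrace X G E₂ hE₂ :=
  supertrace_dinatural X G hE₁ hE₂ f _ fun _ => rfl

end SupertraceDinatural

end HomComplex

end Literature.AlgebraicGeometry.HodgeTheory

end
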